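import Mathlib
import Summits.Schanuel.Schanuel.Theses.RigidCore
import Summits.Schanuel.Schanuel.Theorems.RigidCoreMinimalCounterexampleInAclAclCriterion
import Summits.Schanuel.Schanuel.Theorems.RigidCoreMinimalCounterexampleInAclPureSplit
import Summits.Schanuel.Schanuel.Theorems.RigidCoreMinimalCounterexampleInAclRelationNormalForm
import Summits.Schanuel.Schanuel.Theorems.RigidCoreMinimalCounterexampleInAclMateCoeffGrowth
import Summits.Schanuel.Schanuel.Theorems.RigidCoreMinimalCounterexampleInAclQuadExpDecay
import Summits.Schanuel.Schanuel.Theorems.RigidCoreMinimalCounterexampleInAclMatesLocallyFinite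
import Summits.Schanuel.Schanuel.Theorems.RigidCoreMinimalCounterexampleInAclSelectionCore

/-!
# SECOND-LEVEL SELECTION on the pure rank-2 sector — crux stmt-Schanuel-0969 `RigidCore.MinimalCounterexampleInAcl`

Route `RigidCore`, crux (S*) `MinimalCounterexampleInAcl` (item stmt-Schanuel-0969), line `kernel-arithmetic-selection`
(lead prover-line-stmt-Schanuel-0969-c6-0, skeleton gen 19), `--supports stmt-Schanuel-0969`; registered stubs
`stub_secondLevelSelection` and `crux_iff_secondLevelResidue_and_geThree`.

THE THIRD LEVER OF THE LINE: `acl(∅)`-membership on the PURE sector WITHOUT finiteness of the mates.  Leads c4/c5 recorded that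
every `L_exp`-visible invariant of a mate built from `(x', e^{x'}, 2πi, ℚ̄)` is constant on the mate class ("acl-membership on the
pure sector is finiteness of mates").  That audit covers FIRST-LEVEL invariants only: the SECOND-LEVEL exponentials `e^{x₀²}`,
`e^{x₁²}` are not constant on the mate class, and along the mates of a rank-2 first failure they DECAY SUPER-POLYNOMIALLY —
every mate `y` has `‖e^{±y₀}‖ ≤ C(1+‖y₀‖)^D` (two-sided polynomial size of `ℚ(x,eˣ)`-elements along the ℚ-locus,
`stub_mateCoeffGrowth`, Theorems/…MateCoeffGrowth.lean p125068), hence `|Re y₀| = O(log ‖y₀‖)`, `Re(y₀²) = 2(Re y₀)² − ‖y₀‖² → −∞`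
and `‖e^{y₀²}‖ (1+‖y₀‖)^M ≤ 1` beyond `R_M` (`stub_quadExpDecay`, …QuadExpDecay.lean p124931).  A relation
`Σ_j c_j(x,eˣ) Φ(x)^j = 0`, `c₀(x,eˣ) ≠ 0`, for a `∅`-definable `Φ` with that decay cuts the mates down to the `∅`-definable set
`{y mate | Σ_j c_j(y,e^y) Φ(y)^j = 0} ∋ x`, which is bounded in `y₀` (`stub_selectionCore`, …SelectionCore.lean p125080) hence finite
(`stub_matesLocallyFinite`, …MatesLocallyFinite.lean p124906); with the normal form of an algebraic relation over `ℚ(x,eˣ)`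
(`stub_relationNormalForm`, …RelationNormalForm.lean p124897) this gives:

* `secondLevel_sq0`, `secondLevel_sq1`, **`stub_secondLevelSelection`: if `x` is a rank-2 first failure and `e^{x₀²}` OR `e^{x₁²}` is
  ALGEBRAIC over `K = ℚ(x, eˣ)`, then both coordinates of `x` lie in `acl^{ℂ_exp}(∅)`** — no purity, no finiteness of mates, no
  transcendence input beyond Hermite–Lindemann (the algebraic-coordinate case of the landed acl-criterion);
* `pureResidue_iff_secondLevelResidue`, **`crux_iff_secondLevelResidue_and_geThree`: (S*) ⟺ [(S*)₂ for PURE first failures that are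
  SECOND-LEVEL GENERIC — `e^{x₀²}` and `e^{x₁²}` transcendental over `ℚ(x, eˣ)`] ∧ item stmt-14744** — the pure rank-2 residue of
  the crux shrinks from `PureSparsityTwo` (gen 17, …PureResidue/PureSplit p119573/p120249) to second-level-generic pure first failures;
  `crux_of_secondLevelResidue_of_geThree`, `secondLevelResidue_of_pureSparsityTwo`.
-/

noncomputable section

set_option linter.dupNamespace false

open Complex Set FirstOrder

namespace Summit.Schanuel.Schanuel.Cruxes.MinimalCounterexampleInAcl.KernelArithmeticSelection

open Literature.NumberTheory.Transcendental (SchanuelRank IsDefinedOver zariskiDim)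
open Literature.ModelTheory.ExponentialFields
open Summit.Schanuel.Schanuel.Theorems.AclSubsetLogFreeCore.Negative
open Summit.Schanuel.Schanuel.Theses.RigidCore (MinimalCounterexampleInAcl MinimalCounterexampleInAclGeThree SparsityTwo)

/-! ## Second-level selection with `Φ = e^{y₀²}` -/

/-- `y ↦ e^{y₀²}` is a `∅`-definable function on `ℂ_exp`. [folklore] -/
theorem definableFun_cexp_sq0 :
    (∅ : Set ℂ).DefinableFun Language.expRing (fun y : Fin 2 → ℂ => cexp (y 0 ^ 2)) := by
  have h := definableFun_cexp (definableFun_mul' (definableFun_proj_params (A := (∅ : Set ℂ))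
    (L := Language.expRing) (α := Fin 2) 0) (definableFun_proj_params 0))
  convert h using 2 with y
  rw [sq]

/-- **Decay of `e^{y₀²}` along the mates** of `x` (`trdeg ℚ(x,eˣ) < 2`, `x₀` transcendental): for every `M` there is `R` with
`‖e^{y₀²}‖ (1 + ‖y₀‖)^M ≤ 1` for all mates `y` with `‖y₀‖ ≥ R` — from the two-sided polynomial size of `e^{y₀}` along the locus
(`stub_mateCoeffGrowth` with `F = Y₀`) and `stub_quadExpDecay`. [cite: Polya1920] -/
theorem cexp_sq0_decay {x : Fin 2 → ℂ} (hx : x ∈ firstFailures 2) (hx0 : Transcendental ℚ (x 0)) :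
    ∀ M : ℕ, ∃ R : ℝ, ∀ y : Fin 2 → ℂ, y ∈ locusMates x → R ≤ ‖y 0‖ → ‖cexp (y 0 ^ 2)‖ * (1 + ‖y 0‖) ^ M ≤ 1 := by
  intro M
  obtain ⟨R, C, D, hC, h⟩ := stub_mateCoeffGrowth x hx.2.1 hx0 (MvPolynomial.X (Sum.inr 0))
  obtain ⟨R', hR'⟩ := stub_quadExpDecay C D M hC
  refine ⟨max R R', fun y hy hRy => ?_⟩
  have hev : ∀ v : Fin 2 → ℂ, MvPolynomial.aeval (Sum.elim v (cexp ∘ v)) (MvPolynomial.X (Sum.inr 0) :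
      MvPolynomial (Fin 2 ⊕ Fin 2) ℚ) = cexp (v 0) := fun v => by simp
  obtain ⟨hup, hlow⟩ := h y hy.2 (le_trans (le_max_left _ _) hRy)
  simp only [hev] at hup hlow
  have hlow' := hlow (Complex.exp_ne_zero _)
  refine hR' (y 0) (le_trans (le_max_right _ _) hRy) hup ?_
  -- `‖e^{-y₀}‖ = ‖e^{y₀}‖⁻¹ ≤ C (1 + ‖y₀‖)^D`
  have hpos : 0 < (1 + ‖y 0‖) ^ D := pow_pos (by linarith [norm_nonneg (y 0)]) D
  have hexp_pos : 0 < ‖cexp (y 0)‖ := norm_pos_iff.2 (Complex.exp_ne_zero _)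
  rw [Complex.exp_neg, norm_inv]
  rw [inv_le_comm₀ hexp_pos (mul_pos hC hpos)]
  calc (C * (1 + ‖y 0‖) ^ D)⁻¹ = C⁻¹ * ((1 + ‖y 0‖) ^ D)⁻¹ := by rw [mul_inv]
    _ ≤ ‖cexp (y 0)‖ := hlow'

/-- **SECOND-LEVEL SELECTION, first coordinate: if `e^{x₀²}` is algebraic over `ℚ(x, eˣ)` then `x ∈ acl(∅)²`** (rank-2 first
failure `x`; no purity, no finiteness of mates).  Algebraic `x₀`: the landed acl-criterion; transcendental `x₀`: the normal form
of the relation (`stub_relationNormalForm`), the decay of `e^{y₀²}` (`cexp_sq0_decay`), the growth of the coefficients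
(`stub_mateCoeffGrowth`), local finiteness of the mates (`stub_matesLocallyFinite`) and the selection core (`stub_selectionCore`).
[cite: KirbyMacintyreOnshuus2012, §2] -/
theorem secondLevel_sq0 {x : Fin 2 → ℂ} (hx : x ∈ firstFailures 2)
    (halg : IsAlgebraic ↥(IntermediateField.adjoin ℚ (range x ∪ range (cexp ∘ x))) (cexp (x 0 ^ 2))) :
    ∀ i, x i ∈ expAcl := by
  by_cases h0 : IsAlgebraic ℚ (x 0)
  · exact firstFailure_two_mem_expAcl_of_isAlgebraic_coord hx h0
  have hx0 : Transcendental ℚ (x 0) := h0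
  obtain ⟨d, c, hc0, hrel⟩ := stub_relationNormalForm x (cexp (x 0 ^ 2)) (Complex.exp_ne_zero _) halg
  exact stub_selectionCore x hx (fun y => cexp (y 0 ^ 2)) definableFun_cexp_sq0 (cexp_sq0_decay hx hx0)
    (stub_mateCoeffGrowth x hx.2.1 hx0) (stub_matesLocallyFinite x hx hx0) d c hc0 hrel

/-! ## The coordinate swap -/

/-- Ranges are invariant under the coordinate swap. [folklore] -/
theorem range_comp_swap (x : Fin 2 → ℂ) : range (x ∘ ⇑(Equiv.swap (0 : Fin 2) 1)) = range x :=
  (Equiv.swap (0 : Fin 2) 1).surjective.range_comp x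

/-- The field `ℚ(x, eˣ)` is invariant under the coordinate swap. [folklore] -/
theorem adjoin_comp_swap (x : Fin 2 → ℂ) :
    IntermediateField.adjoin ℚ (range (x ∘ ⇑(Equiv.swap (0 : Fin 2) 1)) ∪ range (cexp ∘ (x ∘ ⇑(Equiv.swap (0 : Fin 2) 1)))) =
      IntermediateField.adjoin ℚ (range x ∪ range (cexp ∘ x)) := by
  rw [← Function.comp_assoc, range_comp_swap, range_comp_swap]

/-- Transport of the transcendence-degree bound along an equality of intermediate fields (the `ℚ`-algebra structures on
both sides are arbitrary: `Algebra ℚ K` is a subsingleton). [folklore] -/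
theorem trdeg_lt_two_transport {K₁ K₂ : IntermediateField ℚ ℂ} (h : K₁ = K₂) {i₁ : Algebra ℚ ↥K₁} {i₂ : Algebra ℚ ↥K₂}
    (h1 : @Algebra.trdeg ℚ ↥K₁ _ _ i₁ < (2 : Cardinal)) : @Algebra.trdeg ℚ ↥K₂ _ _ i₂ < (2 : Cardinal) := by
  subst h
  have hi : i₁ = i₂ := Subsingleton.elim _ _
  subst hi
  exact h1

/-- First failures of rank 2 are invariant under the coordinate swap. [folklore] -/
theorem firstFailures_comp_swap {x : Fin 2 → ℂ} (hx : x ∈ firstFailures 2) :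
    x ∘ ⇑(Equiv.swap (0 : Fin 2) 1) ∈ firstFailures 2 :=
  ⟨hx.1.comp _ (Equiv.swap (0 : Fin 2) 1).injective, trdeg_lt_two_transport (adjoin_comp_swap x).symm hx.2.1, hx.2.2⟩

/-- **SECOND-LEVEL SELECTION, second coordinate: if `e^{x₁²}` is algebraic over `ℚ(x, eˣ)` then `x ∈ acl(∅)²`** (swap +
`secondLevel_sq0`). [cite: KirbyMacintyreOnshuus2012, §2] -/
theorem secondLevel_sq1 {x : Fin 2 → ℂ} (hx : x ∈ firstFailures 2)
    (halg : IsAlgebraic ↥(IntermediateField.adjoin ℚ (range x ∪ range (cexp ∘ x))) (cexp (x 1 ^ 2))) :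
    ∀ i, x i ∈ expAcl := by
  set x' : Fin 2 → ℂ := x ∘ ⇑(Equiv.swap (0 : Fin 2) 1) with hx'
  have hx'ff : x' ∈ firstFailures 2 := firstFailures_comp_swap hx
  have halg' : IsAlgebraic ↥(IntermediateField.adjoin ℚ (range x' ∪ range (cexp ∘ x'))) (cexp (x' 0 ^ 2)) := by
    rw [hx', adjoin_comp_swap]
    simpa using halg
  have h := secondLevel_sq0 hx'ff halg'
  intro i
  have hi : x i = x' ((Equiv.swap (0 : Fin 2) 1) i) := by
    simp only [hx', Function.comp_apply, Equiv.swap_apply_self]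
  rw [hi]
  exact h _

/-! ## The registered stubs -/

/-- **Registered stub `stub_secondLevelSelection` (PROVED): SECOND-LEVEL SELECTION.**  For a rank-2 first failure `x`
(ℚ-linearly independent, `trdeg ℚ(x, eˣ) < 2`, Schanuel in ranks `< 2`): if `e^{x₀²}` or `e^{x₁²}` is algebraic over `ℚ(x, eˣ)`,
then every coordinate of `x` lies in a finite `∅`-definable subset of `ℂ_exp` — WITHOUT purity and WITHOUT finiteness of the
mates. [cite: KirbyMacintyreOnshuus2012, §2] -/
theorem stub_secondLevelSelection : ∀ (x : Fin 2 → ℂ), x ∈ Summit.Schanuel.Schanuel.Cruxes.MinimalCounterexampleInAcl.KernelArithmeticSelection.firstFailures 2 → (IsAlgebraic ↥(IntermediateField.adjoin ℚ (Set.range x ∪ Set.range (Complex.exp ∘ x))) (Complex.exp (x 0 ^ 2)) ∨ IsAlgebraic ↥(IntermediateField.adjoin ℚ (Set.range x ∪ Set.range (Complex.exp ∘ x))) (Complex.exp (x 1 ^ 2))) → ∀ i, x i ∈ Summit.Schanuel.Schanuel.Theorems.AclSubsetLogFreeCore.Negative.expAcl := by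
  intro x hx h
  rcases h with h0 | h1
  · exact secondLevel_sq0 hx h0
  · exact secondLevel_sq1 hx h1

/-- **The pure rank-2 residue ⟺ its second-level-generic part**: second-level algebraic pure first failures are settled by
`stub_secondLevelSelection`. [cite: KirbyMacintyreOnshuus2012, §2] -/
theorem pureResidue_iff_secondLevelResidue :
    (∀ x : Fin 2 → ℂ, x ∈ firstFailures 2 →
        (∀ M : Fin 2 → ℤ, M ≠ 0 → Transcendental ℚ (cexp (∑ i, (M i : ℂ) * x i))) → ∀ i, x i ∈ expAcl) ↔
      ∀ x : Fin 2 → ℂ, x ∈ firstFailures 2 →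
        (∀ M : Fin 2 → ℤ, M ≠ 0 → Transcendental ℚ (cexp (∑ i, (M i : ℂ) * x i))) →
        Transcendental ↥(IntermediateField.adjoin ℚ (range x ∪ range (cexp ∘ x))) (cexp (x 0 ^ 2)) →
        Transcendental ↥(IntermediateField.adjoin ℚ (range x ∪ range (cexp ∘ x))) (cexp (x 1 ^ 2)) →
        ∀ i, x i ∈ expAcl := by
  refine ⟨fun h x hx hpure _ _ i => h x hx hpure i, fun h x hx hpure i => ?_⟩
  by_cases h0 : IsAlgebraic ↥(IntermediateField.adjoin ℚ (range x ∪ range (cexp ∘ x))) (cexp (x 0 ^ 2))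
  · exact secondLevel_sq0 hx h0 i
  by_cases h1 : IsAlgebraic ↥(IntermediateField.adjoin ℚ (range x ∪ range (cexp ∘ x))) (cexp (x 1 ^ 2))
  · exact secondLevel_sq1 hx h1 i
  · exact h x hx hpure h0 h1 i

/-- **Registered stub `crux_iff_secondLevelResidue_and_geThree` (PROVED): THE SECOND-LEVEL SPLIT** — (S*) holds iff (i) every
PURE rank-2 first failure (`e^{Σ Mᵢxᵢ}` transcendental for every non-zero integer vector `M`) that is SECOND-LEVEL GENERIC
(`e^{x₀²}` and `e^{x₁²}` transcendental over `ℚ(x, eˣ)`) has both coordinates in `acl^{ℂ_exp}(∅)`, and (ii) item stmt-Schanuel-14744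
(`MinimalCounterexampleInAclGeThree`, ranks `≥ 3`) holds.  Log sector (every rank), mixed sector (rank 2) and the second-level
algebraic pure sector (rank 2) are theorems. [cite: Kirby2010, Prop. 7.2] -/
theorem crux_iff_secondLevelResidue_and_geThree : Summit.Schanuel.Schanuel.Theses.RigidCore.MinimalCounterexampleInAcl ↔ ((∀ x : Fin 2 → ℂ, x ∈ Summit.Schanuel.Schanuel.Cruxes.MinimalCounterexampleInAcl.KernelArithmeticSelection.firstFailures 2 → (∀ M : Fin 2 → ℤ, M ≠ 0 → Transcendental ℚ (Complex.exp (∑ i, (M i : ℂ) * x i))) → Transcendental ↥(IntermediateField.adjoin ℚ (Set.range x ∪ Set.range (Complex.exp ∘ x))) (Complex.exp (x 0 ^ 2)) → Transcendental ↥(IntermediateField.adjoin ℚ (Set.range x ∪ Set.range (Complex.exp ∘ x))) (Complex.exp (x 1 ^ 2)) → ∀ i, x i ∈ Summit.Schanuel.Schanuel.Theorems.AclSubsetLogFreeCore.Negative.expAcl) ∧ Summit.Schanuel.Schanuel.Theses.RigidCore.MinimalCounterexampleInAclGeThree) := by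
  rw [crux_iff_pureResidue_and_geThree, pureResidue_iff_secondLevelResidue]

/-- **(S*) from the second-level-generic pure residue and item stmt-14744.** [cite: Kirby2010, Prop. 7.2] -/
theorem crux_of_secondLevelResidue_of_geThree
    (hR : ∀ x : Fin 2 → ℂ, x ∈ firstFailures 2 →
        (∀ M : Fin 2 → ℤ, M ≠ 0 → Transcendental ℚ (cexp (∑ i, (M i : ℂ) * x i))) →
        Transcendental ↥(IntermediateField.adjoin ℚ (range x ∪ range (cexp ∘ x))) (cexp (x 0 ^ 2)) →
        Transcendental ↥(IntermediateField.adjoin ℚ (range x ∪ range (cexp ∘ x))) (cexp (x 1 ^ 2)) →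
        ∀ i, x i ∈ expAcl)
    (h₃ : MinimalCounterexampleInAclGeThree) : MinimalCounterexampleInAcl :=
  crux_iff_secondLevelResidue_and_geThree.2 ⟨hR, h₃⟩

/-- **The second-level-generic residue from PURE SPARSITY** (gen 17's `stub_pureSparsityTwo`, via the landed
`stub_rankTwo_pureExp_of_pureSparsityTwo`): the new residue is implied by the old one. [cite: Kirby2010, Prop. 7.2] -/
theorem secondLevelResidue_of_pureSparsityTwo
    (hPSp : ∀ W : Set (Fin 2 ⊕ Fin 2 → ℂ), IsDefinedOver (⊥ : Subfield ℂ) W → zariskiDim ℂ W < 2 →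
      Set.Finite {x : Fin 2 → ℂ | LinearIndependent ℚ x ∧ Sum.elim x (cexp ∘ x) ∈ W ∧
        ∀ M : Fin 2 → ℤ, M ≠ 0 → Transcendental ℚ (cexp (∑ i, (M i : ℂ) * x i))}) :
    ∀ x : Fin 2 → ℂ, x ∈ firstFailures 2 →
      (∀ M : Fin 2 → ℤ, M ≠ 0 → Transcendental ℚ (cexp (∑ i, (M i : ℂ) * x i))) →
      Transcendental ↥(IntermediateField.adjoin ℚ (range x ∪ range (cexp ∘ x))) (cexp (x 0 ^ 2)) →
      Transcendental ↥(IntermediateField.adjoin ℚ (range x ∪ range (cexp ∘ x))) (cexp (x 1 ^ 2)) →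
      ∀ i, x i ∈ expAcl :=
  fun x hx hpure _ _ => stub_rankTwo_pureExp_of_pureSparsityTwo hPSp x hx hpure

/-- **Under the second-level-generic residue, (S*) ⟺ item stmt-14744.** [cite: Kirby2010, Prop. 7.2] -/
theorem crux_iff_geThree_of_secondLevelResidue
    (hR : ∀ x : Fin 2 → ℂ, x ∈ firstFailures 2 →
        (∀ M : Fin 2 → ℤ, M ≠ 0 → Transcendental ℚ (cexp (∑ i, (M i : ℂ) * x i))) →
        Transcendental ↥(IntermediateField.adjoin ℚ (range x ∪ range (cexp ∘ x))) (cexp (x 0 ^ 2)) →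
        Transcendental ↥(IntermediateField.adjoin ℚ (range x ∪ range (cexp ∘ x))) (cexp (x 1 ^ 2)) →
        ∀ i, x i ∈ expAcl) :
    MinimalCounterexampleInAcl ↔ MinimalCounterexampleInAclGeThree :=
  ⟨minimalCounterexampleInAclGeThree_of_minimalCounterexampleInAcl, crux_of_secondLevelResidue_of_geThree hR⟩

end Summit.Schanuel.Schanuel.Cruxes.MinimalCounterexampleInAcl.KernelArithmeticSelection

end
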